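import Mathlib.Analysis.Complex.AbsMax
import Mathlib.Analysis.SpecialFunctions.Complex.LogBounds
import Summits.RiemannHypothesis.RiemannHypothesis.Theorems.JensenPolynomialsPhiCellArith
import HarnessLib

/-!
# Route `JensenPolynomials`, crux `XiWindowZeroFreeRelFar` (stub `stub_elementary`) — real parts on a circle: the
Chebyshev recursion for `Re zᵏ` and the maximum principle for `Re f` (RH-FREE; cell rh-jensen, HUMAN RULING D-0040 / D-0074)

LINE 1 (D-0074 framing): elementary complex analysis; nothing here bears on the zeros of `ζ` or is progress toward RH.

Two elementary tools for CERTIFYING inequalities `Re f(z) ≤ C` on a closed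
disc `‖z‖ ≤ R` when `f` is holomorphic (route `rh-jensen`, crux `XiWindowZeroFreeRelFar`, stub `stub_elementary`:
explicit inequalities for `Log(1 + z)`-expressions on `‖z‖ ≤ 0.3502`):

* **maximum principle for the real part** (`re_le_of_forall_mem_sphere`, `le_re_of_forall_mem_sphere`): if `f` is
  differentiable on the open disc and continuous on the closed disc and `Re f ≤ C` on the circle, then `Re f ≤ C`
  on the closed disc — the maximum modulus principle (Mathlib `Complex.norm_le_of_forall_mem_frontier_norm_le`)
  applied to `exp ∘ f`, `‖e^{f}‖ = e^{Re f}`;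
* **the circle recursion** (`re_pow_add_two_of_normSq`): on `‖z‖² = ρ`, `Re z^{k+2} = 2(Re z)·Re z^{k+1} − ρ·Re zᵏ`
  (`z² = 2(Re z)z − |z|²`), so that `Re zᵏ = t_k(Re z)` for the polynomials `circT ρ x 0 = 1`, `circT ρ x 1 = x`,
  `circT ρ x (k+2) = 2x·circT ρ x (k+1) − ρ·circT ρ x k` (`re_pow_eq_circT`; `t_k(x) = R^kT_k(x/R)`, Chebyshev), and
  the real part of a polynomial with REAL coefficients on the circle is the polynomial `∑ c_k t_k(Re z)`
  (`re_polyC_eq_circEval`). This turns `Re P(z) ≤ C on ‖z‖ = R` into a ONE-variable polynomial inequality on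
  `[−R, R]`, decidable by the interval-arithmetic cell certificates of `JensenPolynomialsPhiCellArith`
  (`pevalR`, `prangeAt`, `covers`), whose vocabulary (`CoeffTable` namespace) this file extends.

WHAT THIS IS NOT: nothing about `ξ` or `ζ`.

## References

* E. C. Titchmarsh, *The Theory of Functions*, 2nd ed. (1939), §5.1 (maximum modulus) and §5.12. [Titchmarsh1939]
* J. C. Mason, D. C. Handscomb, *Chebyshev Polynomials* (2003), §1.2 (`T_k(cos θ) = cos kθ`). [MasonHandscomb2003]
-/

noncomputable section

open Complex Set Metric

-- D-0017: `Summit.RiemannHypothesis.RiemannHypothesis.…` duplicates the namespace BY DESIGN (single-problem summit).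
set_option linter.dupNamespace false

namespace Summit.RiemannHypothesis.RiemannHypothesis.Theorems.JensenPolynomials.CoeffTable

/-! ## 1. The maximum principle for the real part -/

/-- **Maximum principle for `Re f` on a disc**: `f` complex-differentiable on `ball c R`, continuous on its closure,
`Re f ≤ C` on the sphere `‖z − c‖ = R` (`R > 0`) ⟹ `Re f z ≤ C` on the closed ball. [cite: Titchmarsh1939, §5.1] -/
theorem re_le_of_forall_mem_sphere {f : ℂ → ℂ} {c : ℂ} {R C : ℝ} (hR : 0 < R)
    (hd : DiffContOnCl ℂ f (ball c R)) (hC : ∀ z ∈ sphere c R, (f z).re ≤ C) {z : ℂ}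
    (hz : z ∈ closedBall c R) : (f z).re ≤ C := by
  have hg : DiffContOnCl ℂ (fun w => Complex.exp (f w)) (ball c R) :=
    ⟨Complex.differentiable_exp.comp_differentiableOn hd.1,
      Complex.continuous_exp.comp_continuousOn hd.2⟩
  have hfr : ∀ w ∈ frontier (ball c R), ‖Complex.exp (f w)‖ ≤ Real.exp C := by
    intro w hw
    rw [frontier_ball c hR.ne'] at hw
    rw [Complex.norm_exp]
    exact Real.exp_le_exp.2 (hC w hw)
  have hcl : z ∈ closure (ball c R) := by rw [closure_ball c hR.ne']; exact hz
  have h := Complex.norm_le_of_forall_mem_frontier_norm_le isBounded_ball hg hfr hcl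
  rw [Complex.norm_exp] at h
  exact Real.exp_le_exp.1 h

/-- **Minimum principle for `Re f` on a disc** (the maximum principle for `−f`). [cite: Titchmarsh1939, §5.1] -/
theorem le_re_of_forall_mem_sphere {f : ℂ → ℂ} {c : ℂ} {R C : ℝ} (hR : 0 < R)
    (hd : DiffContOnCl ℂ f (ball c R)) (hC : ∀ z ∈ sphere c R, C ≤ (f z).re) {z : ℂ}
    (hz : z ∈ closedBall c R) : C ≤ (f z).re := by
  have h := re_le_of_forall_mem_sphere (f := fun w => -f w) (C := -C) hR hd.neg
    (fun w hw => by simp only [Complex.neg_re]; linarith [hC w hw]) hz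
  simp only [Complex.neg_re] at h
  linarith

/-! ## 2. Real parts of powers on a circle -/

/-- The circle polynomials: `t₀ = 1`, `t₁ = x`, `t_{k+2} = 2x·t_{k+1} − ρ·t_k` (`t_k(x) = Re zᵏ` for `Re z = x`,
`‖z‖² = ρ`; `= R^kT_k(x/R)` with `T_k` the Chebyshev polynomials). [cite: MasonHandscomb2003, §1.2] -/
def circT (ρ x : ℝ) : ℕ → ℝ
  | 0 => 1
  | 1 => x
  | (k + 2) => 2 * x * circT ρ x (k + 1) - ρ * circT ρ x k

/-- `z² = 2(Re z)·z − ‖z‖²` for every complex `z`. [cite: MasonHandscomb2003, §1.2] -/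
theorem sq_eq_two_mul_re_mul_sub_normSq (z : ℂ) :
    z ^ 2 = 2 * (z.re : ℂ) * z - (Complex.normSq z : ℂ) := by
  apply Complex.ext <;> simp [sq, Complex.normSq_apply, Complex.mul_re, Complex.mul_im] <;> ring

/-- **The circle recursion**: if `‖z‖² = ρ` then `Re z^{k+2} = 2(Re z)·Re z^{k+1} − ρ·Re zᵏ`. [cite: MasonHandscomb2003, §1.2] -/
theorem re_pow_add_two_of_normSq {z : ℂ} {ρ : ℝ} (hz : Complex.normSq z = ρ) (k : ℕ) :
    (z ^ (k + 2)).re = 2 * z.re * (z ^ (k + 1)).re - ρ * (z ^ k).re := by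
  have e : z ^ (k + 2) = 2 * (z.re : ℂ) * z ^ (k + 1) - (ρ : ℂ) * z ^ k := by
    rw [pow_add, sq_eq_two_mul_re_mul_sub_normSq, hz]; ring
  rw [e, Complex.sub_re]
  simp [Complex.mul_re]

/-- **`Re zᵏ = t_k(Re z)` on the circle `‖z‖² = ρ`.** [cite: MasonHandscomb2003, §1.2] -/
theorem re_pow_eq_circT {z : ℂ} {ρ : ℝ} (hz : Complex.normSq z = ρ) : ∀ k : ℕ, (z ^ k).re = circT ρ z.re k
  | 0 => by simp [circT]
  | 1 => by simp [circT]
  | (k + 2) => by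
    rw [re_pow_add_two_of_normSq hz k, circT, re_pow_eq_circT hz (k + 1), re_pow_eq_circT hz k]

/-- Evaluation of a rational coefficient list (low degree first) at a complex point. [folklore] -/
def polyC : List ℚ → ℂ → ℂ
  | [], _ => 0
  | c :: cs, z => (c : ℂ) + z * polyC cs z

/-- The same list evaluated "on the circle": `∑_k c_k t_{k}(x)`, written through the shifted recursion
`circEvalFrom ρ x k cs = ∑_j cs_j t_{k+j}(x)`. [cite: MasonHandscomb2003, §1.2] -/
def circEvalFrom (ρ x : ℝ) : ℕ → List ℚ → ℝ
  | _, [] => 0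
  | k, c :: cs => (c : ℝ) * circT ρ x k + circEvalFrom ρ x (k + 1) cs

/-- `Re(z^k · P(z)) = ∑_j c_j t_{k+j}(Re z)` on the circle `‖z‖² = ρ` for a real coefficient list. [cite: MasonHandscomb2003, §1.2] -/
theorem re_pow_mul_polyC_eq {z : ℂ} {ρ : ℝ} (hz : Complex.normSq z = ρ) :
    ∀ (cs : List ℚ) (k : ℕ), (z ^ k * polyC cs z).re = circEvalFrom ρ z.re k cs
  | [], k => by simp [polyC, circEvalFrom]
  | c :: cs, k => by
    have ih := re_pow_mul_polyC_eq hz cs (k + 1)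
    have e : z ^ k * polyC (c :: cs) z = (c : ℂ) * z ^ k + z ^ (k + 1) * polyC cs z := by
      rw [polyC, pow_succ]; ring
    rw [e, Complex.add_re, ih, circEvalFrom]
    congr 1
    rw [show ((c : ℚ) : ℂ) = ((c : ℝ) : ℂ) by norm_cast, Complex.re_ofReal_mul, re_pow_eq_circT hz k]

/-- **Real part of a real polynomial on the circle**: `Re P(z) = ∑_k c_k t_k(Re z)` for `‖z‖² = ρ`.
[cite: MasonHandscomb2003, §1.2] -/
theorem re_polyC_eq_circEval {z : ℂ} {ρ : ℝ} (hz : Complex.normSq z = ρ) (cs : List ℚ) :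
    (polyC cs z).re = circEvalFrom ρ z.re 0 cs := by
  have h := re_pow_mul_polyC_eq hz cs 0
  rwa [pow_zero, one_mul] at h

/-! ## 3. The circle polynomials as coefficient lists (`pevalR` of `JensenPolynomialsPhiCellArith`) -/

/-- Pointwise sum of coefficient lists. [folklore] -/
def ladd : List ℚ → List ℚ → List ℚ
  | [], bs => bs
  | as, [] => as
  | a :: as, b :: bs => (a + b) :: ladd as bs

/-- Scalar multiple of a coefficient list. [folklore] -/
def lscale (c : ℚ) (as : List ℚ) : List ℚ := as.map fun a => c * a

/-- Multiplication by `x` (shift). [folklore] -/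
def lshift (as : List ℚ) : List ℚ := 0 :: as

/-- `pevalR (ladd a b) = pevalR a + pevalR b`. [folklore] -/
theorem pevalR_ladd : ∀ (as bs : List ℚ) (x : ℝ), pevalR (ladd as bs) x = pevalR as x + pevalR bs x
  | [], bs, x => by simp [ladd, pevalR]
  | a :: as, [], x => by simp [ladd, pevalR]
  | a :: as, b :: bs, x => by
    simp only [ladd, pevalR, pevalR_ladd as bs x]; push_cast; ring

/-- `pevalR (lscale c a) = c · pevalR a`. [folklore] -/
theorem pevalR_lscale (c : ℚ) : ∀ (as : List ℚ) (x : ℝ), pevalR (lscale c as) x = (c : ℝ) * pevalR as x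
  | [], x => by simp [lscale, pevalR]
  | a :: as, x => by
    have ih := pevalR_lscale c as x
    simp only [lscale, List.map] at ih ⊢
    simp only [pevalR, ih]; push_cast; ring

/-- `pevalR (lshift a) = x · pevalR a`. [folklore] -/
theorem pevalR_lshift (as : List ℚ) (x : ℝ) : pevalR (lshift as) x = x * pevalR as x := by
  simp [lshift, pevalR]

/-- The coefficient lists of the circle polynomials `t_k` for a rational `ρ`, as the pair `(t_k, t_{k+1})`. [cite: MasonHandscomb2003, §1.2] -/
def circTListPair (ρ : ℚ) : ℕ → List ℚ × List ℚ
  | 0 => ([1], [0, 1])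
  | (k + 1) =>
    let p := circTListPair ρ k
    (p.2, ladd (lscale 2 (lshift p.2)) (lscale (-ρ) p.1))

/-- `pevalR (circTListPair ρ k).1 x = t_k(x)` and `.2 = t_{k+1}(x)`. [cite: MasonHandscomb2003, §1.2] -/
theorem pevalR_circTListPair (ρ : ℚ) (x : ℝ) :
    ∀ k : ℕ, pevalR (circTListPair ρ k).1 x = circT (ρ : ℝ) x k ∧ pevalR (circTListPair ρ k).2 x = circT (ρ : ℝ) x (k + 1)
  | 0 => by simp [circTListPair, pevalR, circT]
  | (k + 1) => by
    obtain ⟨h1, h2⟩ := pevalR_circTListPair ρ x k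
    refine ⟨by simpa [circTListPair] using h2, ?_⟩
    simp only [circTListPair, pevalR_ladd, pevalR_lscale, pevalR_lshift, h1, h2, circT]
    push_cast; ring

/-- The coefficient list of `∑_j cs_j t_{k+j}` ("circle transform" of a coefficient list). [cite: MasonHandscomb2003, §1.2] -/
def circList (ρ : ℚ) : ℕ → List ℚ → List ℚ
  | _, [] => []
  | k, c :: cs => ladd (lscale c (circTListPair ρ k).1) (circList ρ (k + 1) cs)

/-- `pevalR (circList ρ k cs) x = ∑_j cs_j t_{k+j}(x)`. [cite: MasonHandscomb2003, §1.2] -/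
theorem pevalR_circList (ρ : ℚ) (x : ℝ) : ∀ (cs : List ℚ) (k : ℕ),
    pevalR (circList ρ k cs) x = circEvalFrom (ρ : ℝ) x k cs
  | [], k => by simp [circList, pevalR, circEvalFrom]
  | c :: cs, k => by
    rw [circList, pevalR_ladd, pevalR_lscale, (pevalR_circTListPair ρ x k).1, pevalR_circList ρ x cs (k + 1),
      circEvalFrom]

/-- **Summary**: for a rational list `cs`, a rational `ρ ≥ 0` and `‖z‖² = ρ`:
`Re (polyC cs z) = pevalR (circList ρ 0 cs) (Re z)`. [cite: MasonHandscomb2003, §1.2] -/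
theorem re_polyC_eq_pevalR_circList {z : ℂ} {ρ : ℚ} (hz : Complex.normSq z = (ρ : ℝ)) (cs : List ℚ) :
    (polyC cs z).re = pevalR (circList ρ 0 cs) z.re := by
  rw [re_polyC_eq_circEval hz, pevalR_circList]

end Summit.RiemannHypothesis.RiemannHypothesis.Theorems.JensenPolynomials.CoeffTable

end
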